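import Summits.HodgeConjecture.CorCM.AndreRiemannInflation
import Literature.AlgebraicGeometry.Milne1999.TateFromCodesHCOfRiemann
import Literature.NumberTheory.NumberFields.CMFieldCompositum
import Mathlib.NumberTheory.Cyclotomic.Basic
import Mathlib.NumberTheory.NumberField.CMField
import Mathlib.RingTheory.Polynomial.Cyclotomic.Roots
import HarnessLib

/-!
# COR-CM (cell `pub-hodgecm2`), André ↦ Riemann, part 4: every CM abelian variety is a direct factor,
# up to isogeny, of a product of CM-TYPED abelian varieties over ONE Galois CM field — from Riemann's theorem

HONEST FRAMING: the geometric reduction step of the derivation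
`DeligneMilne1982_Thm_6_20_full → Andre1992_hodgeClasses_cmAbelianVariety_mem_span_pullback_weilClasses`,
CONDITIONAL on the displayed Riemann record `hR : HodgeTheory.DeligneMilne1982_Thm_6_20_full`
(Deligne–Milne 1982 Thm. 6.20, fullness of `H¹_B`), exactly as the COR-CM stage-2 statements are.
Milne 2020, proof of Thm. 1: «We may suppose that `A` is a product of simple abelian varieties `A_i`
… Let `F` be a CM subfield of `ℂ`, Galois over `ℚ`, splitting the centre of `End⁰(A)` … For `s ∈ Δ`,
let `A_s = A ⊗_{E,s} F`. Then `A_s` is an abelian variety of CM type `(F, φ_s)`»; Deligne 1982 §5: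
«Since any abelian variety `A` is a product `A = ΠA_α` of simple abelian varieties (up to isogeny) …
Let `B_α = A_α ⊗_{E_α} E`». In the tree's vocabulary:

* the decomposition into CM-TYPED pieces is `Milne1999.hDecompPos_of_hSimplePos` (Poincaré's
  complete reducibility, a theorem; the simple factors are CM-typed by `hSimplePos_of_riemann hR` —
  Shimura §5.1 Props. 5–6 from Riemann's theorem, `Milne1999/TateFromCodesHCOfRiemann`);
* the common Galois CM field is `⨆ᵢ normalClosure ℚ Fᵢ ℂ` over the pieces' CM fields and an
  auxiliary `ℚ(ζ₅)` (so that `[L:ℚ] > 2`): CM and Galois by Shimura §18.2 Lemma (ii)–(iii)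
  (`NumberFields.isCMField_iSup_normalClosure`, `isGalois_iSup_normalClosure_complex`);
* each piece is INFLATED to `L` (`AndreRiemann.exists_inflation`, Shimura §6.2), and the bookkeeping of
  direct factors up to isogeny (`Domination.AVDominatedBy`) runs through `AndreRiemannBiproducts`.

Result: `exists_dominating_cmTypedFamily_of_riemann`. No definition, no named fact.

## References
* [Milne2020HodgeClassesAV] J. S. Milne, *Hodge classes on abelian varieties* (2020), proof of Thm. 1.
* [Deligne1982HodgeCycles] P. Deligne, *Hodge cycles on abelian varieties*, LNM 900, §5.
* [Shimura1998] G. Shimura, *Abelian Varieties with Complex Multiplication and Modular Functions*,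
  §5.1 Props. 5–6, §6.2 Thm. 3, §18.2 Lemma.
* [DeligneMilne1982Tannakian] P. Deligne, J. S. Milne, *Tannakian categories*, LNM 900, Thm. 6.20.
-/

noncomputable section

open CategoryTheory CategoryTheory.Limits NumberField

namespace Summit.HodgeConjecture.CorCM.AndreRiemann

open Literature.AlgebraicGeometry.Motives Literature.AlgebraicGeometry.Motives.AbelianVariety
open Literature.AlgebraicGeometry.HodgeTheory Literature.AlgebraicGeometry.ComplexMultiplication
open Literature.AlgebraicGeometry.Milne1999 Literature.NumberTheory.NumberFields
open Summit.HodgeConjecture.CorCM.Domination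

/-! ## §1 Products of CM-typed abelian varieties are dominated by products of `L`-typed ones -/

/-- **The inductive step over `IsProductOf IsCMTyped`.** A finite product `B` of CM-typed abelian
varieties comes with a finite set `T` of subfields of `ℂ` (images of the CM fields of the pieces),
each finite over `ℚ` and embeddable in a CM field, such that for EVERY number field `L` receiving all
of them, `B` is a direct factor up to isogeny of a finite biproduct of realisations of CM types of
`L` (inflate each piece, Shimura §6.2, and glue). [cite: Milne2020HodgeClassesAV, Theorem 1 (proof)]
[cite: Shimura1998, §6.2 Theorem 3] -/
theorem exists_fields_dominating_family_of_isProductOf {B : AbelianVariety ℂ}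
    (hB : IsProductOf IsCMTyped B) :
    ∃ T : Finset (IntermediateField ℚ ℂ),
      (∀ F ∈ T, FiniteDimensional ℚ F ∧
        ∃ (E : Type) (_ : Field E) (_ : NumberField E) (_ : IsCMField E), Nonempty (F →+* E)) ∧
      ∀ (L : Type) [Field L] [NumberField L],
        (∀ F : T, ((F : IntermediateField ℚ ℂ) →+* L)) →
        ∃ (J : Type) (_ : Fintype J) (C : J → AbelianVariety ℂ) (Ψ : J → CMType L)
          (ι : ∀ j, 𝓞 L →+* End (C j)) (θ : ∀ j, L →+* Module.End ℂ (complexBetti (C j).X 1)),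
          (∀ j, IsCMTypeRealisation (Ψ j) (C j) (ι j) (θ j)) ∧ AVDominatedBy B (⨁ C) := by
  classical
  induction hB with
  | @atom B hBt =>
    obtain ⟨Φ, _, ι, θ, h⟩ := hBt
    rename_i K _ _ _
    obtain ⟨σ⟩ : Nonempty (K →+* ℂ) := inferInstance
    let σ' : K →ₐ[ℚ] ℂ := σ.toRatAlgHom
    refine ⟨{σ'.fieldRange}, fun F hF => ?_, fun L _ _ emb => ?_⟩
    · rw [Finset.mem_singleton] at hF
      subst hF
      exact ⟨σ'.toLinearMap.finiteDimensional_range, K, inferInstance, inferInstance, inferInstance,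
        ⟨σ'.equivFieldRange.symm.toAlgHom.toRingHom⟩⟩
    · let kL : K →+* L := (emb ⟨σ'.fieldRange, Finset.mem_singleton_self _⟩).comp
        σ'.equivFieldRange.toAlgHom.toRingHom
      obtain ⟨B', Ψ, ι', θ', hB', hdom⟩ := exists_inflation h kL
      exact ⟨Fin 1, inferInstance, fun _ => B', fun _ => Ψ, fun _ => ι', fun _ => θ', fun _ => hB',
        hdom.trans (avDominatedBy_biproduct_single B')⟩
  | @prod B₁ B₂ _ _ ih₁ ih₂ =>
    obtain ⟨T₁, hT₁, h₁⟩ := ih₁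
    obtain ⟨T₂, hT₂, h₂⟩ := ih₂
    refine ⟨T₁ ∪ T₂, fun F hF => ?_, fun L _ _ emb => ?_⟩
    · rcases Finset.mem_union.mp hF with hF | hF
      · exact hT₁ F hF
      · exact hT₂ F hF
    · obtain ⟨J₁, _, C₁, Ψ₁, ι₁, θ₁, hC₁, hd₁⟩ :=
        h₁ L fun F => emb ⟨F.1, Finset.mem_union_left _ F.2⟩
      obtain ⟨J₂, _, C₂, Ψ₂, ι₂, θ₂, hC₂, hd₂⟩ :=
        h₂ L fun F => emb ⟨F.1, Finset.mem_union_right _ F.2⟩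
      refine ⟨J₁ ⊕ J₂, inferInstance, sumFam C₁ C₂,
        fun j => match j with | Sum.inl j => Ψ₁ j | Sum.inr j => Ψ₂ j,
        fun j => match j with | Sum.inl j => ι₁ j | Sum.inr j => ι₂ j,
        fun j => match j with | Sum.inl j => θ₁ j | Sum.inr j => θ₂ j,
        fun j => match j with | Sum.inl j => hC₁ j | Sum.inr j => hC₂ j,
        avDominatedBy_prod_of_biproduct hd₁ hd₂⟩

/-! ## §2 The auxiliary field `ℚ(ζ₅)` and the common Galois CM field -/

/-- `ℚ(ζ₅)` is a CM field (Mathlib: nontrivial cyclotomic extensions of `ℚ` are CM). [folklore] -/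
theorem isCMField_cyclotomicField_five : IsCMField (CyclotomicField 5 ℚ) :=
  @IsCyclotomicExtension.Rat.isCMField (CyclotomicField 5 ℚ) _ _ {5} ⟨5, rfl, by norm_num⟩
    (CyclotomicField.isCyclotomicExtension 5 ℚ)

/-- `ℚ(ζ₅)` is Galois over `ℚ`. [folklore] -/
theorem isGalois_cyclotomicField_five : IsGalois ℚ (CyclotomicField 5 ℚ) :=
  @IsCyclotomicExtension.isGalois {5} ℚ (CyclotomicField 5 ℚ) _ _ _
    (CyclotomicField.isCyclotomicExtension 5 ℚ)

/-- `[ℚ(ζ₅) : ℚ] = 4`. [folklore] -/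
theorem finrank_cyclotomicField_five : Module.finrank ℚ (CyclotomicField 5 ℚ) = 4 := by
  have h := @IsCyclotomicExtension.finrank 5 _ ℚ (CyclotomicField 5 ℚ) _ _ _ _
    (CyclotomicField.isCyclotomicExtension 5 ℚ) (Polynomial.cyclotomic.irreducible_rat (n := 5) (by norm_num))
  rw [h]; decide

/-! ## §3 The reduction -/

/-- **Every complex abelian variety of CM type is a direct factor, up to isogeny, of a finite product
of CM-typed abelian varieties over ONE Galois CM field `L` with `[L:ℚ] > 2` — from Riemann's theorem**
(Deligne–Milne Thm. 6.20, displayed hypothesis `hR`). Deligne 1982 §5 / Milne 2020 proof of Thm. 1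
(decompose up to isogeny into simple CM pieces, pass to a Galois CM field containing all their CM
fields, inflate each piece); for `dim A = 0` the empty product serves.
[cite: Deligne1982HodgeCycles, §5] [cite: Milne2020HodgeClassesAV, Theorem 1 (proof)]
[cite: Shimura1998, §5.1 Props. 5–6, §6.2 Thm. 3, §18.2 Lemma] [cite: DeligneMilne1982Tannakian, Thm. 6.20] -/
theorem exists_dominating_cmTypedFamily_of_riemann (hR : DeligneMilne1982_Thm_6_20_full)
    (A : AbelianVariety ℂ) (hA : IsOfCMType A) :
    ∃ (L : Type) (_ : Field L) (_ : NumberField L) (_ : IsCMField L) (_ : IsGalois ℚ L),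
      2 < Module.finrank ℚ L ∧
      ∃ (n : ℕ) (C : Fin n → AbelianVariety ℂ) (Ψ : Fin n → CMType L)
        (ι : ∀ i, 𝓞 L →+* End (C i)) (θ : ∀ i, L →+* Module.End ℂ (complexBetti (C i).X 1)),
        (∀ i, IsCMTypeRealisation (Ψ i) (C i) (ι i) (θ i)) ∧ AVDominatedBy A (⨁ C) := by
  classical
  haveI hcm5 : IsCMField (CyclotomicField 5 ℚ) := isCMField_cyclotomicField_five
  rcases Nat.eq_zero_or_pos A.dim with hA0 | hApos
  · -- dimension `0`: the empty product over `ℚ(ζ₅)`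
    refine ⟨CyclotomicField 5 ℚ, inferInstance, inferInstance, hcm5, isGalois_cyclotomicField_five, ?_, 0,
      fun i => i.elim0, fun i => i.elim0, fun i => i.elim0, fun i => i.elim0, fun i => i.elim0,
      avDominatedBy_of_dim_eq_zero hA0 _⟩
    rw [finrank_cyclotomicField_five]; norm_num
  -- positive dimension: decomposition into CM-typed pieces (Poincaré; simple factors by `hR`)
  obtain ⟨B, hB, hAB⟩ := hDecompPos_of_hSimplePos (hSimplePos_of_riemann hR) A hApos hA
  obtain ⟨T, hT, hclaim⟩ := exists_fields_dominating_family_of_isProductOf hB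
  -- the common field: Galois closure of the compositum of the pieces' fields and `ℚ(ζ₅)`
  let FF : Option T → Type := fun o => match o with
    | none => CyclotomicField 5 ℚ
    | some F => ((F : IntermediateField ℚ ℂ) : Type)
  letI : ∀ o, Field (FF o) := fun o => match o with
    | none => inferInstance
    | some F => inferInstance
  haveI hnf : ∀ o, NumberField (FF o) := fun o => match o with
    | none => inferInstance
    | some F => by
      haveI : FiniteDimensional ℚ (F : IntermediateField ℚ ℂ) := (hT F.1 F.2).1
      exact { to_charZero := inferInstance, to_finiteDimensional := inferInstance }
  have hTR : ∀ o, IsTotallyReal (FF o) ∨ IsCMField (FF o) := fun o => match o with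
    | none => Or.inr hcm5
    | some F => by
      haveI : NumberField ((F : IntermediateField ℚ ℂ) : Type) := hnf (some F)
      obtain ⟨-, E, _, _, hE, ⟨f⟩⟩ := hT F.1 F.2
      exact isTotallyReal_or_isCMField_of_ringHom f (Or.inr hE)
  let L₀ : IntermediateField ℚ ℂ := ⨆ o, IntermediateField.normalClosure ℚ (FF o) ℂ
  haveI : FiniteDimensional ℚ L₀ := IntermediateField.finiteDimensional_iSup_of_finite
  haveI : NumberField L₀ := { to_charZero := inferInstance, to_finiteDimensional := inferInstance }
  have hCM : IsCMField L₀ := isCMField_iSup_normalClosure hTR (i₀ := none) hcm5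
  have hGal : IsGalois ℚ L₀ := isGalois_iSup_normalClosure_complex FF
  -- `[L₀ : ℚ] ≥ [ℚ(ζ₅) : ℚ] = 4`
  have hdeg : 2 < Module.finrank ℚ L₀ := by
    obtain ⟨σ₅⟩ : Nonempty (CyclotomicField 5 ℚ →+* ℂ) := inferInstance
    have hle : σ₅.toRatAlgHom.fieldRange ≤ L₀ :=
      (AlgHom.fieldRange_le_normalClosure σ₅.toRatAlgHom).trans
        (le_iSup (fun o => IntermediateField.normalClosure ℚ (FF o) ℂ) none)
    have h4 : Module.finrank ℚ σ₅.toRatAlgHom.fieldRange = 4 := by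
      rw [← σ₅.toRatAlgHom.equivFieldRange.toLinearEquiv.finrank_eq, finrank_cyclotomicField_five]
    have hmono := IntermediateField.finrank_le_of_le_right hle
    omega
  -- embeddings of the pieces' fields and the dominating family
  have emb : ∀ F : T, ((F : IntermediateField ℚ ℂ) →+* L₀) := fun F =>
    (IntermediateField.inclusion (E := (F : IntermediateField ℚ ℂ)) (F := L₀)
      ((show (F : IntermediateField ℚ ℂ) ≤ IntermediateField.normalClosure ℚ (FF (some F)) ℂ from
        (IntermediateField.fieldRange_val (F : IntermediateField ℚ ℂ)).symm.trans_le
          (AlgHom.fieldRange_le_normalClosure _)).trans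
        (le_iSup (fun o => IntermediateField.normalClosure ℚ (FF o) ℂ) (some F)))).toRingHom
  obtain ⟨J, _, C, Ψ, ι, θ, hC, hdom⟩ := hclaim L₀ emb
  let e : Fin (Fintype.card J) ≃ J := (Fintype.equivFin J).symm
  exact ⟨L₀, inferInstance, inferInstance, hCM, hGal, hdeg, Fintype.card J, C ∘ e, Ψ ∘ e,
    fun i => ι (e i), fun i => θ (e i), fun i => hC (e i),
    avDominatedBy_biproduct_reindex e (hdom.of_isIsogenous hAB)⟩

/-- The same statement in the conjunct shape of `Domination.exists_avDominatedBy_biproduct_realisations_of_riemann`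
(b18, `Model/CMProdBiproduct.lean`) — WITHOUT the records `hU`, `h₃`: Riemann's theorem is the only
hypothesis. [cite: Deligne1982HodgeCycles, §5] [cite: Milne2020HodgeClassesAV, Theorem 1 (proof)]
[cite: DeligneMilne1982Tannakian, Thm. 6.20] -/
theorem exists_avDominatedBy_biproduct_realisations_of_riemann' (hR : DeligneMilne1982_Thm_6_20_full)
    (A : AbelianVariety ℂ) (hA : IsOfCMType A) :
    ∃ (F : Type) (_ : Field F) (_ : NumberField F) (_ : IsCMField F),
      IsGalois ℚ F ∧ 2 < Module.finrank ℚ F ∧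
        ∃ (n : ℕ) (B : Fin n → AbelianVariety ℂ) (Φ : Fin n → CMType F)
          (ι : ∀ i, 𝓞 F →+* End (B i)) (θ : ∀ i, F →+* Module.End ℂ (complexBetti (B i).X 1)),
          (∀ i, IsCMTypeRealisation (Φ i) (B i) (ι i) (θ i)) ∧ AVDominatedBy A (⨁ B) := by
  obtain ⟨L, _, _, hCM, hGal, hdeg, n, C, Ψ, ι, θ, hC, hdom⟩ :=
    exists_dominating_cmTypedFamily_of_riemann hR A hA
  exact ⟨L, inferInstance, inferInstance, hCM, hGal, hdeg, n, C, Ψ, ι, θ, hC, hdom⟩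

end Summit.HodgeConjecture.CorCM.AndreRiemann

end
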